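import Summits.CriticalPhenomena.Ising3DConformalLimit.Theorems.EnergyNotSigmaSquaredMoebiusLimitExistsDefs
import Summits.CriticalPhenomena.Ising3DConformalLimit.Theorems.MoebiusLimitExists.Negative.FreePermutations
import HarnessLib

/-!
# Cluster points of the pinned critical zoom are invariant under the coordinate permutations of `ℝ³`
(line `only-interaction-breaks-moebius`, crux `MoebiusLimitExists`, item stmt-CriticalPhenomena-1344, route
`EnergyNotSigmaSquared`; inherited constraints of the objects of the residue 5′)

`IsClusterPoint.coordPerm_invariant_b3`: a cluster point `S` of the pinned zoom satisfies `S n (P_π ∘ x) = S n x` on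
`NonCoincident 3 n` for every coordinate permutation `P_π` of `ℝ³` (`LinearIsometryEquiv.piLpCongrLeft 2 ℝ ℝ π`), and
everywhere if `S` is normalised (`clusterPoint_coordPerm_invariant`). The lattice approximation commutes EXACTLY with
coordinate permutations and the critical state is hyperoctahedrally invariant (`rescaledCorrelator_coordPerm`, refuter's
`Negative/FreePermutations.lean`), so the pinned zoom is invariant at every mesh and the statement passes to the limit
along the cluster sequence. Together with the invariance under the three coordinate reflections `θ_τ`
(`IsClusterPoint.isReflectionInvariantAlong_os`, …ClusterPointOS.lean) this is invariance of (normalised, continuous off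
the diagonals) cluster points under the full hyperoctahedral group `B₃ = ⟨P_π, θ_τ⟩` — the point group part of the
Euclidean invariance that the residue 5′ would upgrade to `O(3)`. No definitions.
-/

noncomputable section

open Filter Topology Set Function
open Literature.Probability.LatticeModels
open Summit.CriticalPhenomena.Ising3DConformalLimit.MoebiusLimitExistsNegative
  (rescaledCorrelator_coordPerm map_mem_nonCoincident_iff)

namespace Summit.CriticalPhenomena.Ising3DConformalLimit.MoebiusLimitExistsOnlyInteraction

/-- **Cluster points are invariant under coordinate permutations of `ℝ³`** on non-coincident configurations (the pinned
zoom is exactly invariant at every mesh). [cite: FriedliVelenik2017, Exercise 3.14, p. 115] -/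
theorem IsClusterPoint.coordPerm_invariant_b3 {S : CorrFamily 3} (hS : IsClusterPoint S) (π : Equiv.Perm (Fin 3))
    {n : ℕ} {x : Fin n → EuclideanSpace ℝ (Fin 3)} (hx : x ∈ NonCoincident 3 n) :
    S n (fun i => LinearIsometryEquiv.piLpCongrLeft 2 ℝ ℝ π (x i)) = S n x := by
  obtain ⟨u, -, hconv⟩ := hS
  have hRx := (map_mem_nonCoincident_iff (LinearIsometryEquiv.piLpCongrLeft 2 ℝ ℝ π) x).2 hx
  have h1 := (hconv n).tendsto_at hRx
  have h2 := (hconv n).tendsto_at hx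
  exact tendsto_nhds_unique (h1.congr fun k => rescaledCorrelator_coordPerm π n (u k) x) h2

/-- **Registered anchor** (`clusterPoint_coordPerm_invariant`): a NORMALISED cluster point is invariant under the
coordinate permutations of `ℝ³` at every configuration (off `NonCoincident` both sides vanish).
[cite: FriedliVelenik2017, Exercise 3.14, p. 115] -/
theorem clusterPoint_coordPerm_invariant :
    ∀ (S : CorrFamily 3), IsClusterPoint S → IsNormalised S → ∀ (π : Equiv.Perm (Fin 3)) (n : ℕ)
      (x : Fin n → EuclideanSpace ℝ (Fin 3)),
      S n (fun i => LinearIsometryEquiv.piLpCongrLeft 2 ℝ ℝ π (x i)) = S n x := by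
  intro S hS hN π n x
  by_cases hx : x ∈ NonCoincident 3 n
  · exact hS.coordPerm_invariant_b3 π hx
  · have hRx : (fun i => LinearIsometryEquiv.piLpCongrLeft 2 ℝ ℝ π (x i)) ∉ NonCoincident 3 n :=
      fun h => hx ((map_mem_nonCoincident_iff _ x).1 h)
    rw [hN _ _ hRx, hN _ _ hx]

end Summit.CriticalPhenomena.Ising3DConformalLimit.MoebiusLimitExistsOnlyInteraction

end
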